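import Literature.NumberTheory.LFunctions.ConeCharacter
import Mathlib.Algebra.Category.Grp.Injective
import Mathlib.Analysis.SpecialFunctions.Complex.Circle
import HarnessLib

/-!
# Existence of cone characters (Hecke's extension of a Grössencharakter from the numbers to the ideals)

Topic `Literature/NumberTheory/LFunctions`, sequel of `ConeCharacter.lean` (`IsConeChar ν m`: a
character `ν` of the nonzero ideals, `|ν| = 1`, whose value on a principal ideal with a totally
positive generator `β` is the twist `e_m(ι β)`). Everything in this file is PROVED.

Hecke (Math. Z. 6 (1920), §1) defines his Grössencharaktere `λ(μ) = exp(2πi ∑_q m_q y_q(μ))` on the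
(totally positive) NUMBERS `μ` by a linear form in the logarithms of the conjugates that takes integral
values on the (totally positive) units, and extends `λ` to the ideal classes ("für die Idealklassen …
durch `λ(𝔞)^h = λ(α)` für `𝔞^h = (α)`", the `h`-th roots being adjusted to characters). We prove the
extension abstractly: the group `(FractionalIdeal (𝓞 K)⁰ K)ˣ` of fractional ideals contains the
subgroup `P⁺` of principal ideals with a totally positive generator; a linear form
`ℓ : logSpace K → ℝ`, integral on the logarithms of the totally positive units, defines a character
`P⁺ → ℝ/ℤ` (`(β) ↦ ℓ(logMap ι β)`); `ℝ/ℤ` being divisible, the character extends to all fractional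
ideals (Baer's criterion, Mathlib's `Module.Baer.of_divisible`), and composing with `ℝ/ℤ → S¹`,
`t ↦ e^{2πit}`, gives a cone character of frequency `m_i = ℓ(b_i)` (`b_i` the unit-lattice basis).

* `totPos K ≤ Kˣ` — the totally positive elements; `exists_units_of_toPrincipalIdeal_eq_one` — a
  totally positive `x` with `(x) = (1)` is a (totally positive) unit;
* `logForm ℓ : totPos K →* Multiplicative ℝ`, `x ↦ ℓ(logMap ι x)`; `eTwist_freq_eq` — the twist of
  frequency `m = ℓ ∘ b` is `e_m(x) = exp(2πi ℓ(logMap x))`;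
* **`exists_isConeChar`** — for every such `ℓ` there is `ν : Ideal (𝓞 K) →*₀ ℂ` with
  `IsConeChar K ν (fun i ↦ ℓ (logBasis K i))`.

## References

* E. Hecke, *Eine neue Art von Zetafunktionen und ihre Beziehungen zur Verteilung der Primzahlen
  II*, Math. Z. 6 (1920), 11–51, §1 (Definition der Grössencharaktere `λ`). [HeckeMathZ1920]
* T. Mitsui, *Generalized prime number theorem*, Jap. J. Math. 26 (1956), 1–42, §1. [cite: Mitsui1956, §1]

## Mathlib / tree search

Mathlib: `toPrincipalIdeal`, `coe_toPrincipalIdeal`, `FractionalIdeal.mem_one_iff`,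
`FractionalIdeal.spanSingleton_inv`, `QuotientGroup.lift`, `QuotientGroup.quotientKerEquivRange`,
`Module.Baer.of_divisible`, `Module.Baer.extension_property_addMonoidHom`, `DivisibleBy (AddCircle p) ℤ`,
`MonoidHom.toAdditiveLeft`, `MonoidHom.toAdditive`, `AddCircle.toCircle`, `AddCircle.toCircle_apply_mk`,
`AddCircle.toCircle_add`, `Circle.coe_exp`, `Basis.sum_repr`. Tree: `IsConeChar`, `eTwist`,
`coneCoord` (`ConeCharacter`, `TwistedConeCount`).
-/

noncomputable section

open NumberField NumberField.InfinitePlace NumberField.mixedEmbedding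
  NumberField.mixedEmbedding.fundamentalCone NumberField.Units NumberField.Units.dirichletUnitTheorem
  Module Complex
open scoped Real Classical nonZeroDivisors NumberField

namespace Literature.NumberTheory.LFunctions.HeckeCone

variable {K : Type*} [Field K] [NumberField K]

/-! ## Totally positive elements and the principal ideals they generate -/

variable (K) in
/-- **The totally positive elements** `K⁺ ≤ Kˣ`. [cite: HeckeMathZ1920, §1] -/
def totPos : Subgroup Kˣ where
  carrier := {x | NumberField.IsTotPos K (x : K)}
  mul_mem' ha hb := by
    simp only [Set.mem_setOf_eq, Units.val_mul] at *
    exact ha.mul hb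
  one_mem' := by simp only [Set.mem_setOf_eq, Units.val_one]; exact NumberField.isTotPos_one
  inv_mem' ha := by
    simp only [Set.mem_setOf_eq, Units.val_inv_eq_inv_val] at *
    exact ha.inv

omit [NumberField K] in
/-- Membership in `totPos`. [folklore] -/
theorem mem_totPos {x : Kˣ} : x ∈ totPos K ↔ NumberField.IsTotPos K (x : K) := Iff.rfl

/-- **A nonzero `x ∈ K` with `(x) = (1)` is a unit of `𝓞 K`.** [folklore] -/
theorem exists_units_of_toPrincipalIdeal_eq_one {x : Kˣ} (h : toPrincipalIdeal (𝓞 K) K x = 1) :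
    ∃ u : (𝓞 K)ˣ, ((u : 𝓞 K) : K) = x := by
  rw [toPrincipalIdeal_eq_iff, Units.val_one] at h
  have hx : (x : K) ∈ (1 : FractionalIdeal (𝓞 K)⁰ K) := by
    rw [← h]; exact FractionalIdeal.mem_spanSingleton_self _ _
  have hxi : ((x : K)⁻¹) ∈ (1 : FractionalIdeal (𝓞 K)⁰ K) := by
    have h' : FractionalIdeal.spanSingleton (𝓞 K)⁰ ((x : K)⁻¹) = 1 := by
      rw [← FractionalIdeal.spanSingleton_inv, h, inv_one]
    rw [← h']; exact FractionalIdeal.mem_spanSingleton_self _ _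
  rw [FractionalIdeal.mem_one_iff] at hx hxi
  obtain ⟨a, ha⟩ := hx
  obtain ⟨b, hb⟩ := hxi
  have hab : a * b = 1 := by
    apply IsFractionRing.injective (𝓞 K) K
    rw [map_mul, ha, hb, map_one, mul_inv_cancel₀ x.ne_zero]
  exact ⟨Units.mkOfMulEqOne a b hab, ha⟩

/-! ## The logarithmic form on the totally positive elements -/

/-- `logMap` is additive on products of embeddings of nonzero elements. [folklore] -/
theorem logMap_mixedEmbedding_mul {x y : K} (hx : x ≠ 0) (hy : y ≠ 0) :
    logMap (mixedEmbedding K (x * y)) = logMap (mixedEmbedding K x) + logMap (mixedEmbedding K y) := by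
  rw [map_mul, logMap_mul (norm_mixedEmbedding_ne_zero hx) (norm_mixedEmbedding_ne_zero hy)]

/-- **The logarithmic form `x ↦ ℓ(logMap ι x)` on `K⁺`**, as a homomorphism to `(ℝ, +)`.
[cite: HeckeMathZ1920, §1] -/
def logForm (ℓ : logSpace K →ₗ[ℝ] ℝ) : totPos K →* Multiplicative ℝ where
  toFun x := Multiplicative.ofAdd (ℓ (logMap (mixedEmbedding K ((x : Kˣ) : K))))
  map_one' := by
    rw [OneMemClass.coe_one, Units.val_one, map_one, logMap_one, map_zero]; rfl
  map_mul' x y := by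
    rw [← ofAdd_add, ← map_add, Subgroup.coe_mul, Units.val_mul,
      logMap_mixedEmbedding_mul (x : Kˣ).ne_zero (y : Kˣ).ne_zero]

/-- Unfolding lemma for `logForm`. [folklore] -/
theorem logForm_apply (ℓ : logSpace K →ₗ[ℝ] ℝ) (x : totPos K) :
    logForm ℓ x = Multiplicative.ofAdd (ℓ (logMap (mixedEmbedding K ((x : Kˣ) : K)))) := rfl

/-- **The twist of frequency `m = ℓ ∘ b`** is `e_m(x) = exp(2πi ℓ(logMap x))`. [cite: HeckeMathZ1920, §1] -/
theorem eTwist_freq_eq (ℓ : logSpace K →ₗ[ℝ] ℝ) (x : mixedSpace K) :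
    eTwist (fun i ↦ ℓ (logBasis K i)) x = Complex.exp (2 * π * Complex.I * (ℓ (logMap x) : ℝ)) := by
  unfold eTwist
  congr 3
  have hrepr := (logBasis K).sum_repr (logMap x)
  conv_rhs => rw [← hrepr]
  rw [map_sum]
  refine Finset.sum_congr rfl fun i _ ↦ ?_
  rw [map_smul, smul_eq_mul, mul_comm]; rfl

/-! ## The extension -/

/-- **Existence of cone characters (Hecke's extension of `λ` to the ideals).** For a linear form
`ℓ` on the log-space whose values on the logarithms of the totally positive units are integers,
there is a character `ν` of the nonzero ideals of `𝓞 K` with `|ν| = 1` and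
`ν((β)) = exp(2πi ℓ(logMap ι β))` for every totally positive `β`, i.e. a cone character of frequency
`m_i = ℓ(b_i)`. [cite: HeckeMathZ1920, §1] -/
theorem exists_isConeChar (ℓ : logSpace K →ₗ[ℝ] ℝ)
    (hℓ : ∀ u : (𝓞 K)ˣ, NumberField.IsTotPos K ((u : 𝓞 K) : K) → ∃ k : ℤ, ℓ (logEmbedding K (Additive.ofMul u)) = k) :
    ∃ ν : Ideal (𝓞 K) →*₀ ℂ, IsConeChar K ν (fun i ↦ ℓ (logBasis K i)) := by
  -- notation
  set G := (FractionalIdeal (𝓞 K)⁰ K)ˣ with hG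
  set pmap : totPos K →* G := (toPrincipalIdeal (𝓞 K) K).comp (totPos K).subtype with hpmap
  -- the character `x ↦ [ℓ(logMap ι x)] ∈ ℝ/ℤ` on `K⁺`
  set q : Multiplicative ℝ →* Multiplicative (AddCircle (1 : ℝ)) :=
    AddMonoidHom.toMultiplicative (QuotientAddGroup.mk' (AddSubgroup.zmultiples (1 : ℝ))) with hq
  set φ₀ : totPos K →* Multiplicative (AddCircle (1 : ℝ)) := q.comp (logForm ℓ) with hφ₀
  have hφ₀_apply : ∀ x : totPos K,
      φ₀ x = Multiplicative.ofAdd (((ℓ (logMap (mixedEmbedding K ((x : Kˣ) : K))) : ℝ) : AddCircle (1 : ℝ))) :=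
    fun x ↦ rfl
  -- it kills the kernel of `pmap` (the totally positive units)
  have hker : ∀ x ∈ pmap.ker, φ₀ x = 1 := by
    intro x hx
    rw [MonoidHom.mem_ker, hpmap, MonoidHom.comp_apply, Subgroup.coe_subtype] at hx
    obtain ⟨u, hu⟩ := exists_units_of_toPrincipalIdeal_eq_one hx
    have hupos : NumberField.IsTotPos K ((u : 𝓞 K) : K) := by rw [hu]; exact x.2
    obtain ⟨k, hk⟩ := hℓ u hupos
    rw [hφ₀_apply]
    have hlog : logMap (mixedEmbedding K ((x : Kˣ) : K)) = logEmbedding K (Additive.ofMul u) := by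
      rw [← hu, ← logMap_eq_logEmbedding]
    rw [hlog, hk]
    have : ((k : ℝ) : AddCircle (1 : ℝ)) = 0 := by
      rw [AddCircle.coe_eq_zero_iff]; exact ⟨k, by simp⟩
    rw [this]; rfl
  -- descend to `pmap.range = P⁺`
  set φ₁ : pmap.range →* Multiplicative (AddCircle (1 : ℝ)) :=
    (QuotientGroup.lift pmap.ker φ₀ hker).comp (QuotientGroup.quotientKerEquivRange pmap).symm.toMonoidHom with hφ₁
  have hφ₁_apply : ∀ x : totPos K, φ₁ ⟨pmap x, ⟨x, rfl⟩⟩ = φ₀ x := by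
    intro x
    have hx : (QuotientGroup.quotientKerEquivRange pmap).symm ⟨pmap x, ⟨x, rfl⟩⟩ = QuotientGroup.mk x := by
      rw [MulEquiv.symm_apply_eq]; rfl
    rw [hφ₁, MonoidHom.comp_apply, MulEquiv.coe_toMonoidHom, hx, QuotientGroup.lift_mk]
  -- Baer: extend to all fractional ideals
  set f : Additive pmap.range →+ Additive G := MonoidHom.toAdditive pmap.range.subtype with hf
  have hfinj : Function.Injective f := fun a b h ↦ by
    have : (pmap.range.subtype (Additive.toMul a)) = pmap.range.subtype (Additive.toMul b) := h
    exact Additive.toMul.injective (Subtype.ext this)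
  set g : Additive pmap.range →+ AddCircle (1 : ℝ) := MonoidHom.toAdditiveLeft φ₁ with hg
  obtain ⟨Ψ, hΨ⟩ := (Module.Baer.of_divisible (AddCircle (1 : ℝ))).extension_property_addMonoidHom f hfinj g
  have hΨ_apply : ∀ x : totPos K, Ψ (Additive.ofMul (pmap x)) = Multiplicative.toAdd (φ₀ x) := by
    intro x
    have h1 := congrArg (fun F ↦ F (Additive.ofMul ⟨pmap x, ⟨x, rfl⟩⟩)) hΨ
    simp only [AddMonoidHom.coe_comp, Function.comp_apply] at h1
    rw [hg, MonoidHom.toAdditiveLeft_apply_apply] at h1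
    simp only [toMul_ofMul, hφ₁_apply x] at h1
    rw [← h1, hf]
    rfl
  -- the character on the ideals
  set χ : G → ℂ := fun I ↦ (AddCircle.toCircle (Ψ (Additive.ofMul I)) : ℂ) with hχ
  have hχ_mul : ∀ I J : G, χ (I * J) = χ I * χ J := fun I J ↦ by
    simp only [hχ, ofMul_mul, map_add, AddCircle.toCircle_add, Circle.coe_mul]
  have hχ_one : χ 1 = 1 := by
    simp only [hχ, ofMul_one, map_zero]
    rw [← AddCircle.coe_zero, AddCircle.toCircle_apply_mk, mul_zero, Circle.exp_zero, Circle.coe_one]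
  have hχ_norm : ∀ I : G, ‖χ I‖ = 1 := fun I ↦ Circle.norm_coe _
  set mk : Ideal (𝓞 K) → G := fun I ↦
    if h : I = ⊥ then 1 else Units.mk0 (I : FractionalIdeal (𝓞 K)⁰ K) (FractionalIdeal.coeIdeal_ne_zero.2 h) with hmk
  have hmk_mul : ∀ {I J : Ideal (𝓞 K)}, I ≠ ⊥ → J ≠ ⊥ → mk (I * J) = mk I * mk J := by
    intro I J hI hJ
    have hIJ : I * J ≠ ⊥ := mul_ne_zero hI hJ
    simp only [hmk, dif_neg hI, dif_neg hJ, dif_neg hIJ]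
    ext1
    rw [Units.val_mk0, Units.val_mul, Units.val_mk0, Units.val_mk0, FractionalIdeal.coeIdeal_mul]
  let ν : Ideal (𝓞 K) →*₀ ℂ :=
    { toFun := fun I ↦ if I = ⊥ then 0 else χ (mk I)
      map_zero' := by simp only [Ideal.zero_eq_bot, if_true]
      map_one' := by
        have h1 : (1 : Ideal (𝓞 K)) ≠ ⊥ := by simp
        simp only [if_neg h1]
        have : mk 1 = 1 := by
          simp only [hmk, dif_neg h1]; ext1
          simp only [Units.val_mk0, Units.val_one, Ideal.one_eq_top, FractionalIdeal.coeIdeal_top]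
        rw [this, hχ_one]
      map_mul' := fun I J ↦ by
        by_cases hI : I = ⊥
        · simp [hI]
        by_cases hJ : J = ⊥
        · simp [hJ]
        have hIJ : I * J ≠ ⊥ := mul_ne_zero hI hJ
        simp only [if_neg hI, if_neg hJ, if_neg hIJ, hmk_mul hI hJ, hχ_mul] }
  refine ⟨ν, ⟨fun I hI ↦ ?_, fun β hβ hβpos ↦ ?_⟩⟩
  · show ‖(if I = ⊥ then 0 else χ (mk I))‖ = 1
    rw [if_neg hI]; exact hχ_norm _
  · have hβK : (β : K) ≠ 0 := RingOfIntegers.coe_ne_zero_iff.mpr hβ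
    have hspan : Ideal.span {β} ≠ ⊥ := by rwa [Ne, Ideal.span_singleton_eq_bot]
    show (if Ideal.span {β} = ⊥ then 0 else χ (mk (Ideal.span {β}))) = _
    rw [if_neg hspan]
    -- `mk (β) = pmap ⟨β, pos⟩`
    set x : totPos K := ⟨Units.mk0 (β : K) hβK, hβpos⟩ with hx
    have hmkβ : mk (Ideal.span {β}) = pmap x := by
      simp only [hmk, dif_neg hspan, hpmap, MonoidHom.comp_apply, Subgroup.coe_subtype, hx]
      ext1
      rw [Units.val_mk0, coe_toPrincipalIdeal, Units.val_mk0, FractionalIdeal.coeIdeal_span_singleton]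
    rw [hmkβ, hχ]; dsimp only
    rw [hΨ_apply x, hφ₀_apply x, toAdd_ofAdd, AddCircle.toCircle_apply_mk, Circle.coe_exp, eTwist_freq_eq,
      div_one]
    congr 1
    have : ((Units.mk0 (β : K) hβK : Kˣ) : K) = (β : K) := rfl
    simp only [hx, this]
    push_cast
    ring_nf

end Literature.NumberTheory.LFunctions.HeckeCone

end
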